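import Summits.BirchSwinnertonDyer.BirchSwinnertonDyer.Theorems.BiquadraticEisensteinDescentManinDatumSupercuspidalCMInertOfSexticDictionary
import Summits.BirchSwinnertonDyer.BirchSwinnertonDyer.Theorems.BiquadraticEisensteinDescentManinDatumSupercuspidalCMInertSexticCharacterAxiomsJZero
import HarnessLib

set_option linter.dupNamespace false -- `Summit.BirchSwinnertonDyer.BirchSwinnertonDyer.Theorems.…` (summit = sub, D-0017)
set_option autoImplicit false

/-!
# Crux `ManinDatumSupercuspidalCMInert` (stmt-BirchSwinnertonDyer-20111, BED r605), stub `stub_S5` — the sextic dictionary interface with the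
# `5`-factor as a MULTIPLICATIVE function on `𝒪₃/5` in the theta side's own `ω₃`-coordinates (no five axioms, no coordinate change on the E-side)
# (width seat `bsd-wall-cm-bed-w3` g11; theorems only; route cone; `--supports 20111`, helper)

Route `BiquadraticEisensteinDescent` (cell `pub/bsd-wall`). Second form of this seat's D4 interface (`…ModelLValuesSexticOfDictionary`,
`…OfSexticDictionary`), using bed-w1 g8's `…SexticCharacterAxiomsJZero` (p648689: `character_axioms_of_mul`, `mul_of_omega_coords`): the E-side
(bed-w2 g11's `SexticTwistThetaDictionary` (iii)) hands over its `5`-factor as `Ψ₅ : (ℤ/5)² → ℂ` on the classes `c ↔ c₁ + c₂ω₃` of `𝒪₃/5𝒪₃`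
(`ω₃ = (1 + √−3)/2 = ρ + 1`, the coordinates of `QuadOrder.divPoint 3` / `QuadOrder.parityLift`), with

  `Ψ₅ 0 = 0`, `Ψ₅((c₁ + c₂ω₃)(c′₁ + c′₂ω₃)) = Ψ₅(c)Ψ₅(c′)` (`ω₃² = ω₃ − 1`), `Ψ₅(2, −1) = Ψ₅(1 − ρ) = (−ρ²)^e`

(e.g. `Ψ₅ = conj ∘ embC ∘ (·/5)₆^e` read at `x = mkInt c₁ (−c₂)`, `embC x = conj(c₁ + c₂ω₃)`: `(2 + ζ)⁴ ≡ −ζ (mod 5)`, `conj(−ρ) = −ρ²`), and the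
weight factorisation `W(y) = Ψ₅(y₁, y₂)·Ψ(y)` pointwise on `ℤ²`. The weight `Φ(d) = Ψ₅(d₂ − d₁, d₁)` of the `ρ`-coordinates then satisfies the five
axioms of `(·/5)₆^e` and `Φ(y₂, y₁ + y₂) = Ψ₅(y₁, y₂)`, so everything reduces to the first form:

* `oddLValue_sextic_of_dictionary_mulChar` — the `f`-free odd `5`-integrality of `L(E^k ⊗ χ̄, 1)τ(χ)/(iΩ⁻)` modulo the dictionary, `Ψ₅`-form;
* ★ `H5_of_sexticDictionary_mulChar` — `hdictAllMul → H₅` (VERBATIM hypothesis of `…OfH5.maninDatumSupercuspidalCMInert_of_H5`);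
* ★ `maninDatumSupercuspidalCMInert_of_sexticDictionary_mulChar` — `hdictAllMul → ManinDatumSupercuspidalCMInert` (crux BY NAME).

HONEST FRAMING: `hdictAllMul` (the sextic theta dictionary with the `5`-factor split off, over the range of `H₅`) is NOT proved here; the crux,
Manin's conjecture and BSD are NOT proved by this. No definition, no named fact, no `sorry`; axioms standard.
-/

noncomputable section

open scoped Classical
open Complex PeriodPair
open Literature.NumberTheory.EllipticCurves
open Literature.NumberTheory.LFunctions
open Summit.BirchSwinnertonDyer.BirchSwinnertonDyer.Theses.BiquadraticEisensteinDescent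

namespace Summit.BirchSwinnertonDyer.BirchSwinnertonDyer.Theorems.BiquadraticEisensteinDescentManinDatumSupercuspidalCMInertOfSexticDictionaryMulChar

open Summit.BirchSwinnertonDyer.BirchSwinnertonDyer.Theorems.BiquadraticEisensteinDescentManinDatumSupercuspidalCMInertModelLValuesSexticOfDictionary
  (oddLValue_sextic_of_dictionary)
open Summit.BirchSwinnertonDyer.BirchSwinnertonDyer.Theorems.BiquadraticEisensteinDescentManinDatumSupercuspidalCMInertSexticCharacterAxiomsJZero
  (character_axioms_of_mul mul_of_omega_coords)
open Summit.BirchSwinnertonDyer.BirchSwinnertonDyer.Theorems.BiquadraticEisensteinDescentManinDatumSupercuspidalCMInertOfH5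
  (maninDatumSupercuspidalCMInert_of_H5)

/-! ## §1 From the `ω₃`-coordinate multiplicative `5`-factor to the five axioms in `ρ`-coordinates -/

section Coords

variable {e : ℕ} (Ψ₅ : ZMod 5 × ZMod 5 → ℂ) (hΨ₅0 : Ψ₅ 0 = 0)
  (hΨ₅mul : ∀ c c' : ZMod 5 × ZMod 5, Ψ₅ (c.1 * c'.1 - c.2 * c'.2, c.1 * c'.2 + c.2 * c'.1 + c.2 * c'.2) = Ψ₅ c * Ψ₅ c')
  (hΨ₅gen : Ψ₅ (2, -1) = (-(UpperHalfPlane.ρ : ℂ) ^ 2) ^ e)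

omit hΨ₅mul hΨ₅gen in
include hΨ₅0 in
/-- `Φ(0) = Ψ₅(0) = 0` for `Φ(d) = Ψ₅(d₂ − d₁, d₁)`. [folklore] -/
theorem phiOfOmega_zero : (fun d : ZMod 5 × ZMod 5 ↦ Ψ₅ (d.2 - d.1, d.1)) 0 = 0 := by
  simp only [Prod.fst_zero, Prod.snd_zero, sub_zero]
  exact hΨ₅0

include hΨ₅mul hΨ₅gen in
/-- **The five axioms of `(·/5)₆^e` for `Φ(d) = Ψ₅(d₂ − d₁, d₁)`** from multiplicativity in `ω₃`-coordinates and the one value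
`Ψ₅(2, −1) = (−ρ²)^e` (bed-w1 g8's `character_axioms_of_mul` ∘ `mul_of_omega_coords`; `Φ(−1, 1) = Ψ₅(2, −1)`).
[cite: IrelandRosen1982, Ch. 9 §3 and Ch. 14 §2] -/
theorem phiOfOmega_axioms :
    (fun d : ZMod 5 × ZMod 5 ↦ Ψ₅ (d.2 - d.1, d.1)) (0, 1) = 1 ∧
      (∀ d, (fun d : ZMod 5 × ZMod 5 ↦ Ψ₅ (d.2 - d.1, d.1)) (-d) = (fun d : ZMod 5 × ZMod 5 ↦ Ψ₅ (d.2 - d.1, d.1)) d) ∧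
      (∀ d : ZMod 5 × ZMod 5, (fun d : ZMod 5 × ZMod 5 ↦ Ψ₅ (d.2 - d.1, d.1)) (d.2 - d.1, -d.1) =
        (UpperHalfPlane.ρ : ℂ) ^ e * (fun d : ZMod 5 × ZMod 5 ↦ Ψ₅ (d.2 - d.1, d.1)) d) ∧
      (∀ d : ZMod 5 × ZMod 5, (fun d : ZMod 5 × ZMod 5 ↦ Ψ₅ (d.2 - d.1, d.1)) (2 * d.1 - d.2, d.1 + d.2) =
        (-(UpperHalfPlane.ρ : ℂ) ^ 2) ^ e * (fun d : ZMod 5 × ZMod 5 ↦ Ψ₅ (d.2 - d.1, d.1)) d) := by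
  have hgen : (fun d : ZMod 5 × ZMod 5 ↦ Ψ₅ (d.2 - d.1, d.1)) (-1, 1) = (-(UpperHalfPlane.ρ : ℂ) ^ 2) ^ e := by
    simp only
    rw [show (((1 : ZMod 5) - -1, (-1 : ZMod 5)) : ZMod 5 × ZMod 5) = (2, -1) from Prod.ext (by simp only; ring) rfl]
    exact hΨ₅gen
  exact character_axioms_of_mul (fun d : ZMod 5 × ZMod 5 ↦ Ψ₅ (d.2 - d.1, d.1)) (mul_of_omega_coords Ψ₅ hΨ₅mul) hgen

omit hΨ₅0 hΨ₅mul hΨ₅gen in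
/-- The weight read at the `ρ`-coordinates `(y₂, y₁ + y₂)` of `γ = y₁ + y₂ω₃` is `Ψ₅(y₁, y₂)`. [folklore] -/
theorem phiOfOmega_apply_coords (y : ℤ × ℤ) :
    (fun d : ZMod 5 × ZMod 5 ↦ Ψ₅ (d.2 - d.1, d.1)) ((y.2 : ZMod 5), ((y.1 + y.2 : ℤ) : ZMod 5)) =
      Ψ₅ ((y.1 : ZMod 5), (y.2 : ZMod 5)) := by
  simp only
  congr 1
  push_cast
  exact Prod.ext (by simp only; ring) rfl

end Coords

/-! ## §2 The odd `L`-value statement and `H₅`, `Ψ₅`-form -/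

/-- **The `f`-free odd twisted-value statement for `E^k : y² = x³ + k` at `5`, MODULO the sextic theta dictionary with the `5`-factor in
`ω₃`-coordinates.** As `…ModelLValuesSexticOfDictionary.oddLValue_sextic_of_dictionary`, with the `5`-part of the weight given as a multiplicative
`Ψ₅ : (ℤ/5)² → ℂ` on the classes `c₁ + c₂ω₃` with `Ψ₅ 0 = 0`, `Ψ₅(2, −1) = (−ρ²)^e`, and `W(y) = Ψ₅(y₁, y₂)Ψ(y)`.
[cite: Rubin1999, §7.4 Prop. 7.15] [cite: IrelandRosen1982, Ch. 14 §2] -/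
theorem oddLValue_sextic_of_dictionary_mulChar (k : ℤ) (hk : k ≠ 0) {e : ℕ} (he1 : 1 ≤ e) (he5 : e ≤ 5) {k₁ : ℕ}
    (hke : k.natAbs = 5 ^ e * k₁)
    {m : ℕ} [NeZero m] (χ : DirichletCharacter ℂ m) {M' : ℕ} [NeZero M'] (hcop : Nat.Coprime 5 M')
    (Ψ₅ : ZMod 5 × ZMod 5 → ℂ) (hΨ₅0 : Ψ₅ 0 = 0)
    (hΨ₅mul : ∀ c c' : ZMod 5 × ZMod 5, Ψ₅ (c.1 * c'.1 - c.2 * c'.2, c.1 * c'.2 + c.2 * c'.1 + c.2 * c'.2) = Ψ₅ c * Ψ₅ c')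
    (hΨ₅gen : Ψ₅ (2, -1) = (-(UpperHalfPlane.ρ : ℂ) ^ 2) ^ e)
    (Ψ W : ℤ × ℤ → ℂ) (hΨ : ∀ y z : ℤ × ℤ, Ψ (y.1 + M' * z.1, y.2 + M' * z.2) = Ψ y)
    (hΨint : ∀ y : ℤ × ℤ, IsIntegral ℤ (Ψ y))
    (hW : ∀ y : ℤ × ℤ, W y = Ψ₅ ((y.1 : ZMod 5), (y.2 : ZMod 5)) * Ψ y)
    (L : ℂ → ℂ) (hLdiff : Differentiable ℂ L)
    (hL : ∀ s : ℂ, 2 < s.re →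
      L s = LSeries (fun n : ℕ ↦ χ⁻¹ (n : ZMod m) * ((⟨0, 0, 0, 0, (k : ℚ)⟩ : WeierstrassCurve ℚ).LFunction n : ℂ)) s)
    {u : ℂ} (hu : IsIntegral ℤ u) {N : ℕ} (hN : ¬ 5 ∣ N)
    (hL1 : L 1 = u / N * BinaryTheta.thetaLFunction 3 (2 * (5 * M')) 1 (-((Real.sqrt (3 : ℕ) : ℂ) * I))
      (QuadOrder.parityLift W) 1) :
    ∃ L : ℂ → ℂ, Differentiable ℂ L ∧
      (∀ s : ℂ, 2 < s.re →
        L s = LSeries (fun n : ℕ ↦ χ⁻¹ (n : ZMod m) * ((⟨0, 0, 0, 0, (k : ℚ)⟩ : WeierstrassCurve ℚ).LFunction n : ℂ)) s) ∧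
      ∃ s : ℕ, ¬ 5 ∣ s ∧ IsIntegral ℤ ((s : ℂ) * (gaussSum χ (ZMod.stdAddChar (N := m)) * L 1 /
        (Complex.I * ((⟨0, 0, 0, 0, (k : ℚ)⟩ : WeierstrassCurve ℚ).imaginaryPeriodRat : ℂ)))) := by
  obtain ⟨hone, hneg, hrho, hgen'⟩ := phiOfOmega_axioms Ψ₅ hΨ₅mul hΨ₅gen
  refine oddLValue_sextic_of_dictionary k hk he1 he5 hke χ hcop (fun d : ZMod 5 × ZMod 5 ↦ Ψ₅ (d.2 - d.1, d.1))
    (phiOfOmega_zero Ψ₅ hΨ₅0) hone hneg hrho hgen' Ψ W hΨ hΨint (fun y ↦ ?_) L hLdiff hL hu hN hL1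
  have h := phiOfOmega_apply_coords Ψ₅ y
  simp only at h ⊢
  rw [hW y, h]

/-- ★ **`H₅` from the sextic theta dictionary, `Ψ₅`-form.** If for every admissible `(k, ℓ, χ)` of `H₅` the E-side supplies the dictionary data
with the `5`-factor as a multiplicative `Ψ₅` on `𝒪₃/5` in `ω₃`-coordinates (`Ψ₅ 0 = 0`, `Ψ₅(2, −1) = (−ρ²)^e`, `W(y) = Ψ₅(y₁, y₂)Ψ(y)`), then
hypothesis `H₅` of `…OfH5.maninDatumSupercuspidalCMInert_of_H5` holds VERBATIM. [cite: Rubin1999, §7.4 Prop. 7.15] [cite: IrelandRosen1990, Ch. 18 §7] -/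
theorem H5_of_sexticDictionary_mulChar
    (hdictAllMul : ∀ (k : ℤ), k ≠ 0 → (5 : ℤ) ∣ k → (∀ q : ℕ, q.Prime → ¬ ((q : ℤ) ^ 6 ∣ k)) →
      ∀ (ℓ : ℕ) [NeZero ℓ], ℓ.Prime → 5 ≤ ℓ → ¬ (ℓ : ℤ) ∣ k → ¬ 4 ∣ ℓ - 1 → ¬ 5 ∣ ℓ - 1 →
        IsSquare ((5 : ℕ) : ZMod ℓ) →
      ∀ χ : DirichletCharacter ℂ ℓ, χ.Odd →
      ∃ (e k₁ M' : ℕ) (_ : NeZero M') (Ψ₅ : ZMod 5 × ZMod 5 → ℂ) (Ψ W : ℤ × ℤ → ℂ) (L : ℂ → ℂ) (u : ℂ) (N : ℕ),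
        1 ≤ e ∧ e ≤ 5 ∧ k.natAbs = 5 ^ e * k₁ ∧ Nat.Coprime 5 M' ∧
        Ψ₅ 0 = 0 ∧
        (∀ c c' : ZMod 5 × ZMod 5, Ψ₅ (c.1 * c'.1 - c.2 * c'.2, c.1 * c'.2 + c.2 * c'.1 + c.2 * c'.2) = Ψ₅ c * Ψ₅ c') ∧
        Ψ₅ (2, -1) = (-(UpperHalfPlane.ρ : ℂ) ^ 2) ^ e ∧
        (∀ y z : ℤ × ℤ, Ψ (y.1 + M' * z.1, y.2 + M' * z.2) = Ψ y) ∧ (∀ y : ℤ × ℤ, IsIntegral ℤ (Ψ y)) ∧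
        (∀ y : ℤ × ℤ, W y = Ψ₅ ((y.1 : ZMod 5), (y.2 : ZMod 5)) * Ψ y) ∧
        Differentiable ℂ L ∧
        (∀ s : ℂ, 2 < s.re →
          L s = LSeries (fun n : ℕ ↦ χ⁻¹ (n : ZMod ℓ) * ((⟨0, 0, 0, 0, (k : ℚ)⟩ : WeierstrassCurve ℚ).LFunction n : ℂ)) s) ∧
        IsIntegral ℤ u ∧ ¬ 5 ∣ N ∧
        L 1 = u / N * BinaryTheta.thetaLFunction 3 (2 * (5 * M')) 1 (-((Real.sqrt (3 : ℕ) : ℂ) * I))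
          (QuadOrder.parityLift W) 1) :
    ∀ (k : ℤ), k ≠ 0 → (5 : ℤ) ∣ k → (∀ q : ℕ, q.Prime → ¬ ((q : ℤ) ^ 6 ∣ k)) →
      ∀ (ℓ : ℕ) [NeZero ℓ], ℓ.Prime → 5 ≤ ℓ → ¬ (ℓ : ℤ) ∣ k → ¬ 4 ∣ ℓ - 1 → ¬ 5 ∣ ℓ - 1 →
        IsSquare ((5 : ℕ) : ZMod ℓ) →
      ∀ χ : DirichletCharacter ℂ ℓ, χ.Odd →
      ∃ L : ℂ → ℂ, Differentiable ℂ L ∧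
        (∀ s : ℂ, 2 < s.re → L s = LSeries (fun n : ℕ ↦ χ⁻¹ (n : ZMod ℓ) *
          ((⟨0, 0, 0, 0, (k : ℚ)⟩ : WeierstrassCurve ℚ).LFunction n : ℂ)) s) ∧
        ∃ s : ℕ, ¬ 5 ∣ s ∧ IsIntegral ℤ ((s : ℂ) * (gaussSum χ (ZMod.stdAddChar (N := ℓ)) * L 1 /
          (Complex.I * ((⟨0, 0, 0, 0, (k : ℚ)⟩ : WeierstrassCurve ℚ).imaginaryPeriodRat : ℂ)))) := by
  intro k hk h5k h6 ℓ _ hℓ h5ℓ hℓk h4 h5 hsq χ hχ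
  obtain ⟨e, k₁, M', _, Ψ₅, Ψ, W, L, u, N, he1, he5, hke, hcop, hΨ₅0, hΨ₅mul, hΨ₅gen, hΨ, hΨint, hW, hLdiff, hL, hu, hN, hL1⟩ :=
    hdictAllMul k hk h5k h6 ℓ hℓ h5ℓ hℓk h4 h5 hsq χ hχ
  exact oddLValue_sextic_of_dictionary_mulChar k hk he1 he5 hke χ hcop Ψ₅ hΨ₅0 hΨ₅mul hΨ₅gen Ψ W hΨ hΨint hW L hLdiff hL hu hN hL1

/-- ★ **`hdictAllMul → ManinDatumSupercuspidalCMInert`** (crux 20111 BY NAME from the sextic theta dictionary with multiplicative `5`-factor in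
`ω₃`-coordinates; the `j = 1728` half, the CM core, the periods and the assembly are tree theorems). [cite: IrelandRosen1990, Ch. 18 §7]
[cite: Rubin1999, §7.4 Prop. 7.15] [cite: Manin1972, Thm. 1.6] -/
theorem maninDatumSupercuspidalCMInert_of_sexticDictionary_mulChar
    (hdictAllMul : ∀ (k : ℤ), k ≠ 0 → (5 : ℤ) ∣ k → (∀ q : ℕ, q.Prime → ¬ ((q : ℤ) ^ 6 ∣ k)) →
      ∀ (ℓ : ℕ) [NeZero ℓ], ℓ.Prime → 5 ≤ ℓ → ¬ (ℓ : ℤ) ∣ k → ¬ 4 ∣ ℓ - 1 → ¬ 5 ∣ ℓ - 1 →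
        IsSquare ((5 : ℕ) : ZMod ℓ) →
      ∀ χ : DirichletCharacter ℂ ℓ, χ.Odd →
      ∃ (e k₁ M' : ℕ) (_ : NeZero M') (Ψ₅ : ZMod 5 × ZMod 5 → ℂ) (Ψ W : ℤ × ℤ → ℂ) (L : ℂ → ℂ) (u : ℂ) (N : ℕ),
        1 ≤ e ∧ e ≤ 5 ∧ k.natAbs = 5 ^ e * k₁ ∧ Nat.Coprime 5 M' ∧
        Ψ₅ 0 = 0 ∧
        (∀ c c' : ZMod 5 × ZMod 5, Ψ₅ (c.1 * c'.1 - c.2 * c'.2, c.1 * c'.2 + c.2 * c'.1 + c.2 * c'.2) = Ψ₅ c * Ψ₅ c') ∧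
        Ψ₅ (2, -1) = (-(UpperHalfPlane.ρ : ℂ) ^ 2) ^ e ∧
        (∀ y z : ℤ × ℤ, Ψ (y.1 + M' * z.1, y.2 + M' * z.2) = Ψ y) ∧ (∀ y : ℤ × ℤ, IsIntegral ℤ (Ψ y)) ∧
        (∀ y : ℤ × ℤ, W y = Ψ₅ ((y.1 : ZMod 5), (y.2 : ZMod 5)) * Ψ y) ∧
        Differentiable ℂ L ∧
        (∀ s : ℂ, 2 < s.re →
          L s = LSeries (fun n : ℕ ↦ χ⁻¹ (n : ZMod ℓ) * ((⟨0, 0, 0, 0, (k : ℚ)⟩ : WeierstrassCurve ℚ).LFunction n : ℂ)) s) ∧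
        IsIntegral ℤ u ∧ ¬ 5 ∣ N ∧
        L 1 = u / N * BinaryTheta.thetaLFunction 3 (2 * (5 * M')) 1 (-((Real.sqrt (3 : ℕ) : ℂ) * I))
          (QuadOrder.parityLift W) 1) :
    ManinDatumSupercuspidalCMInert :=
  maninDatumSupercuspidalCMInert_of_H5 (H5_of_sexticDictionary_mulChar hdictAllMul)

end Summit.BirchSwinnertonDyer.BirchSwinnertonDyer.Theorems.BiquadraticEisensteinDescentManinDatumSupercuspidalCMInertOfSexticDictionaryMulChar

end
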